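import Literature.Probability.LatticeModels.LatticeLaplacianZd
import Mathlib.Analysis.SpecialFunctions.Pow.Real
import HarnessLib

/-!
# Crux `PositiveSolutionAsymptotics` (stmt-CriticalPhenomena-4496), line `registered`:
# stub P `stub_propagateBall` — one Harnack step on a comparison ball

THEOREM-ONLY helper file (`--supports stmt-CriticalPhenomena-4496`). One step of the Harnack chain
of the reshaped assembly: if a Harnack inequality with constant `Cst` holds for all nonnegative
solutions `w` of `Δw = Vw` on `D` between points within Euclidean distance `Rh` of the centre `z`,
then near-maximality of `q = u · nrm^{α}` propagates from `z` to every `z' ∈ D` within distance `Rh`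
of `z` with `nrm z' ≤ 3 nrm z`, with loss `Cst · 3^{α} · (4ηQ + ζ)`. The comparison function is
`w = (Q/(1-η))·H - u` (no Doob transform), where `H` is the local comparison solution with boundary
values `nrm^{-α}`. Everything is [folklore].
-/

namespace Summit.CriticalPhenomena.Ising3DConformalLimit.Theorems.PositiveSolutionAsymptotics

open Literature.Probability.LatticeModels Finset

/-- **P (one Harnack step on a comparison ball, no Doob transform).** Let `D ⊆ ℤ³` and suppose every
`w ≥ 0` on `D ∪ ∂D` solving `Δw = Vw` on `D` satisfies `w x ≤ Cst · w y` whenever `x, y` lie within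
Euclidean distance `Rh` of `z`. Let `u > 0` solve `Δu = Vu` on `D`, let `H` solve `ΔH = VH` on `D`
with `H = nrm^{-α}` on `∂D` and `(1-η) nrm^{-α} ≤ H ≤ (1+η) nrm^{-α}` on `D` (`nrm > 0` any function;
the Euclidean norm in the application), let `q = u · nrm^{α} ≤ Q` on `D ∪ ∂D` and `q(z) ≥ Q - ζ`.
Then for `z' ∈ D` within distance `Rh` of `z ∈ D` with `nrm z' ≤ 3 nrm z`:
`q(z') ≥ Q - Cst·3^α·(4ηQ + ζ)`. Proof: `w := (Q/(1-η))·H - u ≥ 0` on `D ∪ ∂D` solves `Δw = Vw` on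
`D`; `w(z) ≤ nrm(z)^{-α}(4ηQ + ζ)` and `w(z') ≥ nrm(z')^{-α}(Q - q(z'))`; Harnack `w(z') ≤ Cst·w(z)`
and `(nrm z'/nrm z)^{α} ≤ 3^{α}`. [folklore] -/
theorem stub_propagateBall :
    ∀ (u V H nrm : Literature.Probability.LatticeModels.Site 3 → ℝ) (α η Q ζ Cst Rh : ℝ)
      (D : Set (Literature.Probability.LatticeModels.Site 3)) (z z' : Literature.Probability.LatticeModels.Site 3),
      (∀ w : Literature.Probability.LatticeModels.Site 3 → ℝ,
        (∀ x ∈ D ∪ Literature.Probability.LatticeModels.zdOuterBoundary D, 0 ≤ w x) →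
        (∀ x ∈ D, Literature.Probability.LatticeModels.latticeLaplacianZd w x = V x * w x) →
        ∀ x y : Literature.Probability.LatticeModels.Site 3,
          Real.sqrt (∑ i, (((x i : ℤ) : ℝ) - ((z i : ℤ) : ℝ)) ^ 2) ≤ Rh →
          Real.sqrt (∑ i, (((y i : ℤ) : ℝ) - ((z i : ℤ) : ℝ)) ^ 2) ≤ Rh → w x ≤ Cst * w y) →
      1 ≤ Cst → 0 ≤ η → η ≤ 1 / 2 → 0 ≤ Q → 0 ≤ ζ → 0 ≤ α → 0 ≤ Rh →
      z ∈ D → z' ∈ D → Real.sqrt (∑ i, (((z' i : ℤ) : ℝ) - ((z i : ℤ) : ℝ)) ^ 2) ≤ Rh →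
      (∀ x ∈ D ∪ Literature.Probability.LatticeModels.zdOuterBoundary D, 0 < u x) →
      (∀ x ∈ D, Literature.Probability.LatticeModels.latticeLaplacianZd u x = V x * u x) →
      (∀ x ∈ D, Literature.Probability.LatticeModels.latticeLaplacianZd H x = V x * H x) →
      (∀ x ∈ D ∪ Literature.Probability.LatticeModels.zdOuterBoundary D, 0 < nrm x) →
      (∀ y ∈ Literature.Probability.LatticeModels.zdOuterBoundary D, H y = nrm y ^ (-α)) →
      (∀ x ∈ D, (1 - η) * nrm x ^ (-α) ≤ H x ∧ H x ≤ (1 + η) * nrm x ^ (-α)) →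
      nrm z' ≤ 3 * nrm z →
      (∀ x ∈ D ∪ Literature.Probability.LatticeModels.zdOuterBoundary D, u x * nrm x ^ α ≤ Q) →
      Q - ζ ≤ u z * nrm z ^ α →
      Q - Cst * (3 : ℝ) ^ α * (4 * η * Q + ζ) ≤ u z' * nrm z' ^ α := by
  intro u V H nrm α η Q ζ Cst Rh D z z' hHar hCst hη0 hη hQ hζ hα hRh hzD hz'D hdist _hupos hueq hHeq
    hnorm hHoff hHbd hnz hqQ hqz
  -- positivity bookkeeping
  have h1η : 0 < 1 - η := by linarith
  have hCst0 : 0 ≤ Cst := by linarith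
  have hzU : z ∈ D ∪ zdOuterBoundary D := Or.inl hzD
  have hz'U : z' ∈ D ∪ zdOuterBoundary D := Or.inl hz'D
  have hpow : ∀ x ∈ D ∪ zdOuterBoundary D, nrm x ^ α * nrm x ^ (-α) = 1 := fun x hx => by
    rw [← Real.rpow_add (hnorm x hx), add_neg_cancel, Real.rpow_zero]
  have hnp : ∀ x ∈ D ∪ zdOuterBoundary D, 0 < nrm x ^ (-α) := fun x hx =>
    Real.rpow_pos_of_pos (hnorm x hx) _
  -- `u x = q x * nrm x ^ (-α)`, hence `u x ≤ Q * nrm x ^ (-α)` on `D ∪ ∂D`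
  have hu_eq : ∀ x ∈ D ∪ zdOuterBoundary D, u x = u x * nrm x ^ α * nrm x ^ (-α) :=
    fun x hx => by rw [mul_assoc, hpow x hx, mul_one]
  have huQ : ∀ x ∈ D ∪ zdOuterBoundary D, u x ≤ Q * nrm x ^ (-α) := fun x hx => by
    rw [hu_eq x hx]
    exact mul_le_mul_of_nonneg_right (hqQ x hx) (hnp x hx).le
  -- the constant `Q' = Q / (1 - η)`
  obtain ⟨Q', hQ'⟩ : ∃ Q' : ℝ, Q' = Q / (1 - η) := ⟨_, rfl⟩
  have hQ'mul : Q' * (1 - η) = Q := by rw [hQ']; exact div_mul_cancel₀ _ h1η.ne'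
  have hQ'0 : 0 ≤ Q' := by rw [hQ']; exact div_nonneg hQ h1η.le
  have hQ'Q : Q ≤ Q' := by
    rw [hQ', le_div_iff₀ h1η]; nlinarith
  have hQ'2 : Q' ≤ 2 * Q := by
    rw [hQ', div_le_iff₀ h1η]; nlinarith
  -- the comparison function `w = Q'·H - u`
  obtain ⟨w, hw⟩ : ∃ w : Site 3 → ℝ, w = fun x => Q' * H x - u x := ⟨_, rfl⟩
  have hw_apply : ∀ x, w x = Q' * H x - u x := fun x => by rw [hw]
  -- (i) `w ≥ 0` on `D ∪ ∂D`
  have hw0 : ∀ x ∈ D ∪ zdOuterBoundary D, 0 ≤ w x := by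
    intro x hx
    rw [hw_apply]
    have hux := huQ x hx
    by_cases hxD : x ∈ D
    · have hH := (hHbd x hxD).1
      have : Q * nrm x ^ (-α) ≤ Q' * H x :=
        calc Q * nrm x ^ (-α) = Q' * ((1 - η) * nrm x ^ (-α)) := by rw [← hQ'mul]; ring
          _ ≤ Q' * H x := mul_le_mul_of_nonneg_left hH hQ'0
      linarith
    · have hxB : x ∈ zdOuterBoundary D := hx.resolve_left hxD
      rw [hHoff x hxB]
      have : Q * nrm x ^ (-α) ≤ Q' * nrm x ^ (-α) :=
        mul_le_mul_of_nonneg_right hQ'Q (hnp x hx).le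
      linarith
  -- (ii) `Δw = Vw` on `D`
  have hweq : ∀ x ∈ D, latticeLaplacianZd w x = V x * w x := by
    intro x hx
    have e : w = (fun y => Q' * H y) - u := hw.trans (funext fun y => rfl)
    rw [e, latticeLaplacianZd_sub, latticeLaplacianZd_const_mul, hHeq x hx, hueq x hx, Pi.sub_apply]
    ring
  -- (iii) the Harnack inequality between `z'` and `z`
  have hzz : Real.sqrt (∑ i, (((z i : ℤ) : ℝ) - ((z i : ℤ) : ℝ)) ^ 2) ≤ Rh := by
    simpa using hRh
  have hHz : w z' ≤ Cst * w z := hHar w hw0 hweq z' z hdist hzz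
  -- (iv) `w z ≤ nrm z ^ (-α) * (4ηQ + ζ)`
  have hwz : w z ≤ nrm z ^ (-α) * (4 * η * Q + ζ) := by
    rw [hw_apply]
    have hH := (hHbd z hzD).2
    have h1 : Q' * H z ≤ Q' * ((1 + η) * nrm z ^ (-α)) := mul_le_mul_of_nonneg_left hH hQ'0
    have h2 : (Q - ζ) * nrm z ^ (-α) ≤ u z := by
      rw [hu_eq z hzU]
      exact mul_le_mul_of_nonneg_right hqz (hnp z hzU).le
    -- `Q'(1+η) = Q + 2ηQ' ≤ Q + 4ηQ`
    have h3 : Q' * (1 + η) ≤ Q + 4 * η * Q := by nlinarith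
    have h4 := mul_le_mul_of_nonneg_right h3 (hnp z hzU).le
    linarith
  -- (v) `w z' ≥ nrm z' ^ (-α) * Q - u z'`
  have hwz' : nrm z' ^ (-α) * Q - u z' ≤ w z' := by
    rw [hw_apply]
    have hH := (hHbd z' hz'D).1
    have e : nrm z' ^ (-α) * Q = Q' * ((1 - η) * nrm z' ^ (-α)) := by rw [← hQ'mul]; ring
    rw [e]
    linarith [mul_le_mul_of_nonneg_left hH hQ'0]
  -- (vi) combine and multiply by `nrm z' ^ α`
  have hmain : nrm z' ^ (-α) * Q - u z' ≤ Cst * (nrm z ^ (-α) * (4 * η * Q + ζ)) :=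
    hwz'.trans (hHz.trans (mul_le_mul_of_nonneg_left hwz hCst0))
  have hmul := mul_le_mul_of_nonneg_left hmain (Real.rpow_nonneg (hnorm z' hz'U).le α)
  have lhs : nrm z' ^ α * (nrm z' ^ (-α) * Q - u z') = Q - u z' * nrm z' ^ α := by
    calc nrm z' ^ α * (nrm z' ^ (-α) * Q - u z')
          = nrm z' ^ α * nrm z' ^ (-α) * Q - u z' * nrm z' ^ α := by ring
      _ = Q - u z' * nrm z' ^ α := by rw [hpow z' hz'U, one_mul]
  have rhs : nrm z' ^ α * (Cst * (nrm z ^ (-α) * (4 * η * Q + ζ))) =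
      Cst * (nrm z' ^ α * nrm z ^ (-α)) * (4 * η * Q + ζ) := by ring
  have hrat : nrm z' ^ α * nrm z ^ (-α) = (nrm z' / nrm z) ^ α := by
    rw [Real.rpow_neg (hnorm z hzU).le, Real.div_rpow (hnorm z' hz'U).le (hnorm z hzU).le,
      div_eq_mul_inv]
  rw [lhs, rhs, hrat] at hmul
  -- `(nrm z'/nrm z)^α ≤ 3^α`
  have h3α : (nrm z' / nrm z) ^ α ≤ (3 : ℝ) ^ α := by
    refine Real.rpow_le_rpow (div_nonneg (hnorm z' hz'U).le (hnorm z hzU).le) ?_ hα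
    rw [div_le_iff₀ (hnorm z hzU)]
    exact hnz
  have hK : 0 ≤ 4 * η * Q + ζ := add_nonneg (mul_nonneg (mul_nonneg (by norm_num) hη0) hQ) hζ
  have hfin : Cst * (nrm z' / nrm z) ^ α * (4 * η * Q + ζ) ≤ Cst * (3 : ℝ) ^ α * (4 * η * Q + ζ) :=
    mul_le_mul_of_nonneg_right (mul_le_mul_of_nonneg_left h3α hCst0) hK
  linarith

end Summit.CriticalPhenomena.Ising3DConformalLimit.Theorems.PositiveSolutionAsymptotics
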